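/-
Copyright (c) 2026 the pub-hodgecm-mathlib formalisation cell (harness21).  Prover seat hodgecm-mathlib-LH5-p02 (g4): line LH3 (closer stub `stub_N9`), LETTER L1 clause (I₁) FACES,
LH3-plan (g4) RULING #18 (H-core) L3 §3 — the CORE PACKAGE at EVERY one-wall point (real walls at the split places allowed): (A5a″) ∘ held-out family ∘ cut-off ∘ L1.
-/
import Literature.NumberTheory.Rogawski1990.ArchOrbFamGHeldOutFamily               -- ★ p851298 (this seat): `exists_smooth_heldOut_family`; brings ★ (A4′), ★ (A5a), ★ `isOpen_setOf_inRegAt`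
import Literature.NumberTheory.Rogawski1990.ArchOrbFamGUnfoldedModelHeldOut          -- ★ p851278∕p851293 (F0P3b-p01 (g17)): L2 (A5a′)∕(A5a″) `orbFamG_eq_integral_descConj_unfoldedModel_heldOut_of_regG`
import Literature.NumberTheory.Rogawski1990.ArchLocalWallDescentParam                -- ★ p851272 (LH1-p03 (g6)): L1 `exists_descent_box_local_param`
import Literature.NumberTheory.Rogawski1990.ArchOrbFamGExtBoxDescentInRegAt          -- ★ p851249∕p851255 (this seat): `isOpen_setOf_wallBox`; brings ★ p851168 `…_of_corePackage`, ★ p851016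
import Literature.NumberTheory.Rogawski1990.ArchCentralDescentAssemblyKit            -- ★ p842630: `isMulRightInvariant_of_isHaarMeasure_archLocal_diagonal_of_im_eq_zero` (unimodularity of `U(α)_w`)
import Literature.NumberTheory.Automorphic.ArchProductHaarReading                    -- ★ `exists_isHaarMeasure_eq_map_archPiEquivCM_symm_pi`
import HarnessLib

/-!
# (H-core) L3 §3: the (B-desc′) CORE PACKAGE and HEAD at EVERY one-wall point — real walls at the split places ALLOWED
# (parabolic unfolding of the split places BEFORE the `w₀`-descent; Varadarajan 1977 I §1.12, Rogawski 1990 §4.12 + §8.2, Shelstad 1979 §4)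

Topic `NumberTheory/Rogawski1990`; namespace `Literature.NumberTheory.Rogawski1990`.  THEOREMS ONLY (no `def`, no instance, no notation, no axiom, no named fact, no `sorry`);
kernel lane `--kind proof --supports stmt-HodgeConjecture-24833`.  Cell `pub/hodgecm-mathlib`, crux H413 (`stmt-HodgeConjecture-24833`), F0∕P3c line LH3 (closer stub `stub_N9`),
LETTER L1 clause (I₁) FACES, LH3-plan (g4) RULING #18 road «(H-core) = L1 (LH1-p03 (g6)) + L2 (F0P3b-p01 (g17)) + L3 (this seat)».  ★ p851249 did the one-wall points OFF the
real walls by the `Z(γ_p)`-descent; at a one-wall point whose split coordinate sits ON a real wall (`x_w = 0`) that descent fails (noncompact centraliser at `w`), so here the split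
places are UNFOLDED FIRST (L2 ★ (A5a″): `orbFamG c = PREF(c) · ∫_{U_{w₀}⧸T′_{w₀}} descConj γ_{w₀}(c) T′ (u ↦ B(c,u))`), the held-out family `B(c, ·)` is a smooth matrix-currency family
with uniform support (★ §1–§2 `exists_smooth_heldOut_family`, over ★ (A4′)), it is CUT OFF smoothly in the spectator coordinates to a globally smooth family (the cut-off is `1` near the
base point), and L1 ★ `exists_descent_box_local_param` descends the `w₀`-place with the spectator as a parameter.
* `exists_descent_box_orbFamG_corePackage` — ★ p851168's `hpack` binder at EVERY one-wall base point (no `x_w ≠ 0` hypothesis): `K ≠ 0`, open `U ∋ x`, `f` jointly `C^∞`, uniform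
  matrix support, tangential clause, `U ∩ {off the w₀-wall} ⊆ InRegG`, and `orbFamG c = Φ₀(c) · (K · ∫_{U(J)} f(c, ↑↑(h T(c) h⁻¹)) dμ₀)` on `U ∩ RegG S`.
* `exists_descent_box_orbFamGExt_inRegG` — THE (B-desc′) HEAD (LH7-p04 (g4)'s signature, ★ p851168's 8 clauses VERBATIM) := ★ `…_of_corePackage` ∘ the above.
HONEST LABEL: HC_CM is proved only modulo the 7 printed citations (2 remaining named inputs: hLiu418 = `stmt-HodgeConjecture-24832`, h413 = `stmt-HodgeConjecture-24833`) until rung 0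
closes; count-neutral assembly (pays O-L1c-b through LH3-p02's ★ `faceJetBounds_onRealWall_of_boxDescentOn` once (L3-asm) lands).

## References
* [Varadarajan1977] V. S. Varadarajan, *Harmonic Analysis on Real Reductive Groups*, LNM 576 (1977), Part I §1.12.
* [Rogawski1990] J. D. Rogawski, *Automorphic Representations of Unitary Groups in Three Variables*, Ann. of Math. Stud. 123 (1990), §4.12 Lemma 4.12.1 p. 61, §8.2 pp. 118–124.
* [Shelstad1979] D. Shelstad, *Characters and inner forms of a quasi-split group over ℝ*, Compositio Math. 39 (1979), §4 pp. 22–25.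
* [Bouaziz1994IntegralesOrbitales] A. Bouaziz, *Intégrales orbitales sur les groupes de Lie réductifs*, Ann. Sci. ÉNS 27 (1994), §6.2 p. 591.
-/

set_option autoImplicit false

noncomputable section

open MeasureTheory MeasureTheory.Measure NumberField NumberField.InfinitePlace NumberField.mixedEmbedding Matrix Complex Set Filter Topology
open scoped MatrixGroups Matrix Real Classical ENNReal NNReal ContDiff Matrix.Norms.Operator Pointwise
open Literature.NumberTheory.Automorphic Literature.NumberTheory.Automorphic.UnitaryGroup Literature.NumberTheory.Automorphic.ArchCartan
open Literature.NumberTheory.GaloisRepresentations Literature.MeasureTheory.Group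

namespace Literature.NumberTheory.Rogawski1990

section Core

variable (L : Type) [Field L] [NumberField L] [IsCMField L] (α : Fin 3 → L)
  [MeasurableSpace ↥(arch (↥(maximalRealSubfield L)) L (IsCMField.complexConj L) 3 (Matrix.diagonal α))]
  [BorelSpace ↥(arch (↥(maximalRealSubfield L)) L (IsCMField.complexConj L) 3 (Matrix.diagonal α))]
  (ν' : Measure ↥(arch (↥(maximalRealSubfield L)) L (IsCMField.complexConj L) 3 (Matrix.diagonal α))) [ν'.IsHaarMeasure] [ν'.IsMulRightInvariant]

omit [IsCMField L] in
/-- **The two box conditions are open**: slot `1` simple at `w₀` and in-regular at the other compact places (no condition at the split places). [cite: Bouaziz1994IntegralesOrbitales, §6.2 p. 591] -/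
theorem isOpen_setOf_wallBox₂ (S : Finset {w : InfinitePlace L // IsComplex w}) (w₀ : {w : InfinitePlace L // IsComplex w}) :
    IsOpen {c : {w : InfinitePlace L // IsComplex w} → Fin 3 → ℝ |
      (∀ j : Fin 3, j ≠ 1 → Circle.exp (c w₀ 1) ≠ Circle.exp (c w₀ j)) ∧
        (∀ w, w ∉ S → w ≠ w₀ → ∀ i j : Fin 3, i ≠ j → slotSign L α w i ≠ slotSign L α w j → Circle.exp (c w i) ≠ Circle.exp (c w j))} := by
  have hO1 : IsOpen {c : {w : InfinitePlace L // IsComplex w} → Fin 3 → ℝ | ∀ j : Fin 3, j ≠ 1 → Circle.exp (c w₀ 1) ≠ Circle.exp (c w₀ j)} := by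
    have h : {c : {w : InfinitePlace L // IsComplex w} → Fin 3 → ℝ | ∀ j : Fin 3, j ≠ 1 → Circle.exp (c w₀ 1) ≠ Circle.exp (c w₀ j)} =
        ⋂ j ∈ {j : Fin 3 | j ≠ 1}, {c | Circle.exp (c w₀ 1) ≠ Circle.exp (c w₀ j)} := by
      ext c; simp only [mem_setOf_eq, mem_iInter]
    rw [h]
    exact (Set.toFinite _).isOpen_biInter fun j _ => isOpen_ne_fun (continuous_circleExp_coord w₀ 1) (continuous_circleExp_coord w₀ j)
  have hO2 : IsOpen {c : {w : InfinitePlace L // IsComplex w} → Fin 3 → ℝ |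
      ∀ w, w ∉ S → w ≠ w₀ → ∀ i j : Fin 3, i ≠ j → slotSign L α w i ≠ slotSign L α w j → Circle.exp (c w i) ≠ Circle.exp (c w j)} := by
    have h : {c : {w : InfinitePlace L // IsComplex w} → Fin 3 → ℝ |
          ∀ w, w ∉ S → w ≠ w₀ → ∀ i j : Fin 3, i ≠ j → slotSign L α w i ≠ slotSign L α w j → Circle.exp (c w i) ≠ Circle.exp (c w j)} =
        ⋂ w ∈ {w : {w : InfinitePlace L // IsComplex w} | w ∉ S ∧ w ≠ w₀}, ⋂ q ∈ {q : Fin 3 × Fin 3 | q.1 ≠ q.2 ∧ slotSign L α w q.1 ≠ slotSign L α w q.2},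
          {c | Circle.exp (c w q.1) ≠ Circle.exp (c w q.2)} := by
      ext c
      simp only [mem_setOf_eq, mem_iInter, Prod.forall, and_imp]
    rw [h]
    exact (Set.toFinite _).isOpen_biInter fun w _ => (Set.toFinite _).isOpen_biInter fun q _ =>
      isOpen_ne_fun (continuous_circleExp_coord w q.1) (continuous_circleExp_coord w q.2)
  have h : {c : {w : InfinitePlace L // IsComplex w} → Fin 3 → ℝ |
      (∀ j : Fin 3, j ≠ 1 → Circle.exp (c w₀ 1) ≠ Circle.exp (c w₀ j)) ∧
        (∀ w, w ∉ S → w ≠ w₀ → ∀ i j : Fin 3, i ≠ j → slotSign L α w i ≠ slotSign L α w j → Circle.exp (c w i) ≠ Circle.exp (c w j))} =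
      {c : {w : InfinitePlace L // IsComplex w} → Fin 3 → ℝ | ∀ j : Fin 3, j ≠ 1 → Circle.exp (c w₀ 1) ≠ Circle.exp (c w₀ j)} ∩
        {c | ∀ w, w ∉ S → w ≠ w₀ → ∀ i j : Fin 3, i ≠ j → slotSign L α w i ≠ slotSign L α w j → Circle.exp (c w i) ≠ Circle.exp (c w j)} := by
    ext c; simp only [mem_inter_iff, mem_setOf_eq]
  rw [h]
  exact hO1.inter hO2

set_option maxHeartbeats 1600000 in
/-- **(H-core) CORE PACKAGE AT EVERY ONE-WALL POINT — ★ p851168's `hpack` binder with NO real-wall hypothesis.**  Base point `x`: the noncompact coincidence `x_{w₀0} = x_{w₀2}`,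
`e^{ix_{w₀1}} ≠ e^{ix_{w₀0}}` at the covered compact place `w₀ ∉ S`, IN-REGULAR at the other compact places, split coordinates ARBITRARY (real walls `x_w = 0` allowed);
`a′ ∈ C_c^∞(G′_∞)`, any Haar `μ₀` on `U(J)`.  THEN `K ≠ 0`, an open `U ∋ x` and a jointly smooth, uniformly matrix-compactly-supported, tangential `f` with `U ∩ {off the w₀-wall} ⊆ InRegG` and
**`orbFamG L α ν′ a′ S c = Φ₀(c) · (K · ∫_{U(J)} f(c, ↑↑(h · P diag(e^{ic_{w₀0}}, e^{ic_{w₀2}}) P⁻¹ · h⁻¹)) dμ₀)` for every `G`-REGULAR `c ∈ U`** — L2 ★ (A5a″) (split places unfolded, `w₀` held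
out) ∘ ★ `exists_smooth_heldOut_family` (the held-out family in matrix currency) ∘ a smooth cut-off in the spectator coordinates ∘ L1 ★ `exists_descent_box_local_param` (the `w₀`-descent
with the spectator as parameter). [cite: Varadarajan1977, I §1.12] [cite: Rogawski1990, §4.12 Lemma 4.12.1 p. 61; §8.2 pp. 118–124] [cite: Shelstad1979, §4 pp. 22–25] -/
theorem exists_descent_box_orbFamG_corePackage (hα : ∀ i, α i ≠ 0)
    (hreal : ∀ (w : {w : InfinitePlace L // IsComplex w}) (i : Fin 3), (w.1.embedding (α i)).im = 0)
    {J : Matrix (Fin 2) (Fin 2) ℂ} (hJ : J = (StdForm.antidiagonal 2).over ℂ)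
    [MeasurableSpace ↥(unitaryGroupOfForm (starRingEnd ℂ) J)] [BorelSpace ↥(unitaryGroupOfForm (starRingEnd ℂ) J)]
    [LocallyCompactSpace ↥(unitaryGroupOfForm (starRingEnd ℂ) J)] [SecondCountableTopology ↥(unitaryGroupOfForm (starRingEnd ℂ) J)]
    (μ₀ : Measure ↥(unitaryGroupOfForm (starRingEnd ℂ) J)) [μ₀.IsHaarMeasure] [μ₀.IsMulRightInvariant]
    {S : Finset {w : InfinitePlace L // IsComplex w}} {w₀ : {w : InfinitePlace L // IsComplex w}} {x : ({w : InfinitePlace L // IsComplex w} → Fin 3 → ℝ)}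
    (hS : ∀ w, w ∈ S → w ∈ splitChartPlaces L α) (hw₀ : w₀ ∉ S) (hwsp : w₀ ∈ splitChartPlaces L α)
    (hx02 : x w₀ 0 = x w₀ 2) (hx1 : Circle.exp (x w₀ 1) ≠ Circle.exp (x w₀ 0))
    (hxin : ∀ w, w ∉ S → w ≠ w₀ → ∀ i j : Fin 3, i ≠ j → slotSign L α w i ≠ slotSign L α w j → Circle.exp (x w i) ≠ Circle.exp (x w j))
    {a' : ↥(arch (↥(maximalRealSubfield L)) L (IsCMField.complexConj L) 3 (Matrix.diagonal α)) → ℂ} (ha' : ArchSmooth L 3 (Matrix.diagonal α) a') :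
    ∃ (K : ℂ) (U : Set ({w : InfinitePlace L // IsComplex w} → Fin 3 → ℝ)) (f : ({w : InfinitePlace L // IsComplex w} → Fin 3 → ℝ) × Matrix (Fin 2) (Fin 2) ℂ → ℂ),
      K ≠ 0 ∧ IsOpen U ∧ x ∈ U ∧ ContDiff ℝ ∞ f ∧
      (∃ C : Set (Matrix (Fin 2) (Fin 2) ℂ), IsCompact C ∧ ∀ c X, X ∉ C → f (c, X) = 0) ∧
      (∀ c X, f (c, X) = f (Function.update c w₀ ![0, c w₀ 1, 0], X)) ∧
      (∀ c ∈ U, Circle.exp (c w₀ 0) ≠ Circle.exp (c w₀ 2) → c ∈ InRegG (slotSign L α) S) ∧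
      ∀ c ∈ U, c ∈ RegG S →
        orbFamG L α ν' a' S c =
          (1 - (Circle.exp (c w₀ 1 - c w₀ 0) : ℂ)) * (1 - (Circle.exp (c w₀ 2 - c w₀ 0) : ℂ)) * (1 - (Circle.exp (c w₀ 2 - c w₀ 1) : ℂ)) *
          (K * ∫ h : ↥(unitaryGroupOfForm (starRingEnd ℂ) J),
            f (c, (((h * ⟨Matrix.GeneralLinearGroup.mkOfDetNeZero !![(1 : ℂ), 1; 1, -1] det_cayleyTwo_ne_zero *
                  circleDiagonal 2 ![Circle.exp (c w₀ 0), Circle.exp (c w₀ 2)] *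
                  (Matrix.GeneralLinearGroup.mkOfDetNeZero !![(1 : ℂ), 1; 1, -1] det_cayleyTwo_ne_zero)⁻¹,
                cayley_conj_circleDiagonal_mem_of_eq_over hJ _⟩ * h⁻¹ : ↥(unitaryGroupOfForm (starRingEnd ℂ) J)) : GL (Fin 2) ℂ) : Matrix (Fin 2) (Fin 2) ℂ)) ∂μ₀) := by
  /- (0) Borel structures and topological facts on the local groups and the quotients -/
  letI : ∀ w : {w : InfinitePlace L // IsComplex w}, MeasurableSpace ↥(archLocal L 3 (Matrix.diagonal α) w) := fun w => borel _
  haveI : ∀ w : {w : InfinitePlace L // IsComplex w}, BorelSpace ↥(archLocal L 3 (Matrix.diagonal α) w) := fun w => ⟨rfl⟩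
  haveI : ∀ w : {w : InfinitePlace L // IsComplex w}, LocallyCompactSpace ↥(archLocal L 3 (Matrix.diagonal α) w) := fun w => locallyCompactSpace_archLocal_three L α w
  haveI : ∀ w : {w : InfinitePlace L // IsComplex w}, SecondCountableTopology ↥(archLocal L 3 (Matrix.diagonal α) w) := fun w => secondCountableTopology_archLocal_three L α w
  letI : ∀ w : {w : InfinitePlace L // IsComplex w}, MeasurableSpace (↥(archLocal L 3 (Matrix.diagonal α) w) ⧸ chartTorusGLoc L α w S) := fun w => borel _
  haveI : ∀ w : {w : InfinitePlace L // IsComplex w}, BorelSpace (↥(archLocal L 3 (Matrix.diagonal α) w) ⧸ chartTorusGLoc L α w S) := fun w => ⟨rfl⟩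
  letI : MeasurableSpace ((∀ w : {w : {w : {w : InfinitePlace L // IsComplex w} // w ∉ S} // w.1 ≠ w₀}, ↥(archLocal L 3 (Matrix.diagonal α) w.1.1)) ⧸ Subgroup.pi Set.univ (fun w : {w : {w : {w : InfinitePlace L // IsComplex w} // w ∉ S} // w.1 ≠ w₀} => chartTorusGLoc L α w.1.1 S)) := borel _
  haveI : BorelSpace ((∀ w : {w : {w : {w : InfinitePlace L // IsComplex w} // w ∉ S} // w.1 ≠ w₀}, ↥(archLocal L 3 (Matrix.diagonal α) w.1.1)) ⧸ Subgroup.pi Set.univ (fun w : {w : {w : {w : InfinitePlace L // IsComplex w} // w ∉ S} // w.1 ≠ w₀} => chartTorusGLoc L α w.1.1 S)) := ⟨rfl⟩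
  /- (1) the product reading of `ν′`; unimodularity of the local factors -/
  obtain ⟨ν'w, hν'w, hν⟩ := exists_isHaarMeasure_eq_map_archPiEquivCM_symm_pi L 3 α ν'
  haveI : ∀ w, (ν'w w).IsHaarMeasure := hν'w
  haveI : ∀ w, (ν'w w).IsMulRightInvariant := fun w => isMulRightInvariant_of_isHaarMeasure_archLocal_diagonal_of_im_eq_zero L α hα w (hreal w) (ν'w w)
  /- (2) torus Haar measures -/
  haveI : ∀ w : {w : InfinitePlace L // IsComplex w}, (chartHaarGLoc L α w S).IsHaarMeasure := fun w => isHaarMeasure_chartHaarGLoc L α w S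
  haveI : ∀ w : {w : InfinitePlace L // IsComplex w}, (chartHaarGLoc L α w S).IsInvInvariant := fun w => isInvInvariant_chartHaarGLoc L α w S
  haveI : ∀ w : {w : InfinitePlace L // IsComplex w}, SigmaFinite (chartHaarGLoc L α w S) := fun w => sigmaFinite_chartHaarGLoc L α w S
  obtain ⟨ρrest, hρ1, hρ2, hρ⟩ := exists_haar_map_subgroupPiCoords_eq_pi
    (fun w : {w : {w : {w : InfinitePlace L // IsComplex w} // w ∉ S} // w.1 ≠ w₀} => chartTorusGLoc L α w.1.1 S) (fun w => isClosed_chartTorusGLoc L α w.1.1 S)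
    (fun w : {w : {w : {w : InfinitePlace L // IsComplex w} // w ∉ S} // w.1 ≠ w₀} => chartHaarGLoc L α w.1.1 S)
  haveI := hρ1
  haveI := hρ2
  /- (3) the standard split group `U(J₃)(ℂ)` -/
  obtain ⟨J₃, hJ₃⟩ : ∃ J₃ : Matrix (Fin 3) (Fin 3) ℂ, J₃ = (StdForm.antidiagonal 3).over ℂ := ⟨_, rfl⟩
  letI : MeasurableSpace ↥(unitaryGroupOfForm (starRingEnd ℂ) J₃) := borel _
  haveI : BorelSpace ↥(unitaryGroupOfForm (starRingEnd ℂ) J₃) := ⟨rfl⟩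
  letI : MeasurableSpace (↥(unitaryGroupOfForm (starRingEnd ℂ) J₃) ⧸ torusU (starRingEnd ℂ) J₃) := borel _
  haveI : BorelSpace (↥(unitaryGroupOfForm (starRingEnd ℂ) J₃) ⧸ torusU (starRingEnd ℂ) J₃) := ⟨rfl⟩
  haveI : LocallyCompactSpace ↥(unitaryGroupOfForm (starRingEnd ℂ) J₃) := locallyCompactSpace_unitaryGroupOfForm_complex J₃
  haveI : SecondCountableTopology ↥(unitaryGroupOfForm (starRingEnd ℂ) J₃) := secondCountableTopology_unitaryGroupOfForm_complex J₃
  obtain ⟨K, hK, -, hKB⟩ := exists_isCompact_subgroup_unitary_mul_borelU hJ₃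
  haveI : CompactSpace ↥K := isCompact_iff_compactSpace.mp hK
  haveI : LocallyCompactSpace ↥K := hK.isClosed.isClosedEmbedding_subtypeVal.locallyCompactSpace
  obtain ⟨κ, hκ⟩ : ∃ κ : Measure ↥K, κ.IsHaarMeasure := ⟨Measure.haar, inferInstance⟩
  haveI := hκ
  have hN : IsClosed (unipotentU (starRingEnd ℂ) J₃ : Set ↥(unitaryGroupOfForm (starRingEnd ℂ) J₃)) := LineRing.isClosed_unipotentU _ _
  haveI : LocallyCompactSpace ↥(unipotentU (starRingEnd ℂ) J₃) := hN.isClosedEmbedding_subtypeVal.locallyCompactSpace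
  obtain ⟨μN, hμN⟩ : ∃ μN : Measure ↥(unipotentU (starRingEnd ℂ) J₃), μN.IsHaarMeasure := ⟨Measure.haar, inferInstance⟩
  haveI := hμN
  obtain ⟨τ, hτT, hτcoe, hτmul, hτd⟩ := exists_torusU_boostEig_family hJ₃
  /- (4) the frames at the split places and the Iwasawa constants -/
  choose φ hφ hT hφT using fun w : {w : {w : InfinitePlace L // IsComplex w} // w ∈ S} => exists_continuousMulEquiv_archLocal_splitChart_torusU L α w.1 hα (hS _ w.2) hJ₃
  choose T hT using hT
  have hφT' : ∀ (w : {w : {w : InfinitePlace L // IsComplex w} // w ∈ S}) (g : ↥(archLocal L 3 (Matrix.diagonal α) w.1)), (φ w).toMulEquiv g ∈ torusU (starRingEnd ℂ) J₃ ↔ g ∈ chartTorusGLoc L α w.1 S :=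
    fun w g => hφT w S hS w.2 g
  have hφd : ∀ (w : {w : {w : InfinitePlace L // IsComplex w} // w ∈ S}) (cw : Fin 3 → ℝ), glDiagonal 3 ℂ (fun i => Units.mk0 (boostEig cw i) (boostEig_ne_zero cw i)) =
      ((φ w (gprimeBlockAt L α w.1 S cw) : ↥(unitaryGroupOfForm (starRingEnd ℂ) J₃)) : GL (Fin 3) ℂ) := fun w cw => (hφ w S (fun _ => cw) w.2).2.1
  have hC : ∀ w : {w : {w : InfinitePlace L // IsComplex w} // w ∈ S}, ∃ C : ℝ≥0, 0 < C ∧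
      (quotientMeasure (chartTorusGLoc L α w.1 S) (chartHaarGLoc L α w.1 S) (isClosed_chartTorusGLoc L α w.1 S) (ν'w w.1)).map
          (cosetCongr (φ w).toMulEquiv (chartTorusGLoc L α w.1 S) (torusU (starRingEnd ℂ) J₃) (hφT' w)) = C • Measure.map
        (fun p : ↥K × ↥(unipotentU (starRingEnd ℂ) J₃) =>
          (QuotientGroup.mk ((p.1 : ↥(unitaryGroupOfForm (starRingEnd ℂ) J₃)) * (p.2 : ↥(unitaryGroupOfForm (starRingEnd ℂ) J₃))) : ↥(unitaryGroupOfForm (starRingEnd ℂ) J₃) ⧸ torusU (starRingEnd ℂ) J₃))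
        (κ.prod μN) := fun w => by
    haveI := smulInvariantMeasure_quotientMeasure (chartTorusGLoc L α w.1 S) (chartHaarGLoc L α w.1 S) (isClosed_chartTorusGLoc L α w.1 S) (ν'w w.1)
    exact exists_map_cosetCongr_eq_smul_map_of_frame hJ₃ (chartTorusGLoc L α w.1 S) (φ w) (hφT' w) hK hKB κ μN _
      (quotientMeasure_ne_zero (chartTorusGLoc L α w.1 S) (chartHaarGLoc L α w.1 S) (isClosed_chartTorusGLoc L α w.1 S) (ν'w w.1))
  choose C hCpos hμC using hC
  /- (5) L2 (A5a″): `w₀` outside, unfolded inside — with the inner family named `INNER` -/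
  obtain ⟨INNER, hINNERdef⟩ : ∃ INNER : ({w : InfinitePlace L // IsComplex w} → Fin 3 → ℝ) → ↥(archLocal L 3 (Matrix.diagonal α) w₀) → ℂ, INNER = fun c u => ∫ q : ({w : {w : InfinitePlace L // IsComplex w} // w ∈ S} → ↥K × ↥(unipotentU (starRingEnd ℂ) J₃)) × ((∀ w : {w : {w : {w : InfinitePlace L // IsComplex w} // w ∉ S} // w.1 ≠ w₀}, ↥(archLocal L 3 (Matrix.diagonal α) w.1.1)) ⧸ Subgroup.pi Set.univ (fun w : {w : {w : {w : InfinitePlace L // IsComplex w} // w ∉ S} // w.1 ≠ w₀} => chartTorusGLoc L α w.1.1 S)),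
            a' ((archPiEquivCM 3 L (Matrix.diagonal α)).symm (Function.update (fun w =>
              if h : w ∈ S then
                (φ ⟨w, h⟩).symm (((q.1 ⟨w, h⟩).1 : ↥(unitaryGroupOfForm (starRingEnd ℂ) J₃)) *
                  (τ ![0, c w 1, c w 2] * τ ![c w 0 / 2, 0, 0] * ((q.1 ⟨w, h⟩).2 : ↥(unitaryGroupOfForm (starRingEnd ℂ) J₃)) * τ ![c w 0 / 2, 0, 0]) *
                  ((q.1 ⟨w, h⟩).1 : ↥(unitaryGroupOfForm (starRingEnd ℂ) J₃))⁻¹)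
              else if h₀ : w = w₀ then 1
              else
                descConj (fun w : {w : {w : {w : InfinitePlace L // IsComplex w} // w ∉ S} // w.1 ≠ w₀} => gprimeBlock L α w.1.1 S c)
                  (Subgroup.pi Set.univ (fun w : {w : {w : {w : InfinitePlace L // IsComplex w} // w ∉ S} // w.1 ≠ w₀} => chartTorusGLoc L α w.1.1 S))
                  (forall_mem_pi_chartTorusGLoc_comm L α S (fun w : {w : {w : {w : InfinitePlace L // IsComplex w} // w ∉ S} // w.1 ≠ w₀} => w.1.1) c)
                  (fun g => (g ⟨⟨w, h⟩, h₀⟩ : ↥(archLocal L 3 (Matrix.diagonal α) w))) q.2)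
              w₀ u))
            ∂((Measure.pi fun _ : {w : {w : InfinitePlace L // IsComplex w} // w ∈ S} => κ.prod μN).prod
              (quotientMeasure (Subgroup.pi Set.univ (fun w : {w : {w : {w : InfinitePlace L // IsComplex w} // w ∉ S} // w.1 ≠ w₀} => chartTorusGLoc L α w.1.1 S)) ρrest
                (isClosed_coe_pi _ fun w => isClosed_chartTorusGLoc L α w.1.1 S) (Measure.pi fun w : {w : {w : {w : InfinitePlace L // IsComplex w} // w ∉ S} // w.1 ≠ w₀} => ν'w w.1.1))) := ⟨_, rfl⟩
  have hA : ∀ c : ({w : InfinitePlace L // IsComplex w} → Fin 3 → ℝ), c ∈ RegG S → orbFamG L α ν' a' S c =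
      (∏ w ∈ Finset.univ.filter (fun w => w ∉ S),
          ((1 - (Circle.exp (c w 1 - c w 0) : ℂ)) * (1 - (Circle.exp (c w 2 - c w 0) : ℂ)) * (1 - (Circle.exp (c w 2 - c w 1) : ℂ)))) *
        (∏ w, ((chartHaarGLoc L α w S (chartBoxImgGLoc L α w S)).toReal : ℂ)) * ((∏ w : {w : {w : InfinitePlace L // IsComplex w} // w ∈ S}, (C w : ℝ) : ℝ) : ℂ) *
        ∫ x₀ : ↥(archLocal L 3 (Matrix.diagonal α) w₀) ⧸ chartTorusGLoc L α w₀ S,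
          descConj (gprimeBlockAt L α w₀ S (c w₀)) (chartTorusGLoc L α w₀ S) (forall_mem_chartTorusGLoc_comm L α w₀ S (c w₀)) (INNER c) x₀
          ∂(quotientMeasure (chartTorusGLoc L α w₀ S) (chartHaarGLoc L α w₀ S) (isClosed_chartTorusGLoc L α w₀ S) (ν'w w₀)) := by
    intro c hc
    rw [hINNERdef]
    exact orbFamG_eq_integral_descConj_unfoldedModel_heldOut_of_regG L α S ν'w ν' hν (fun w => chartHaarGLoc L α w S) hw₀ ρrest hρ hJ₃ φ hφT' hφd κ μN hμC
      τ hτT hτcoe hτmul hτd hα hS ha'.continuous ha'.hasCompactSupport hc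
  /- (6) the held-out family in matrix currency (★ §1–§2) -/
  obtain ⟨Ξ, hΞs, ⟨C₀, hC₀, hB0⟩, hBΞ, hΞw₀⟩ := exists_smooth_heldOut_family L α S hα hreal hS hw₀ hJ₃ K hK κ μN φ T hT τ hτcoe
    (quotientMeasure (Subgroup.pi Set.univ (fun w : {w : {w : {w : InfinitePlace L // IsComplex w} // w ∉ S} // w.1 ≠ w₀} => chartTorusGLoc L α w.1.1 S)) ρrest
      (isClosed_coe_pi _ fun w => isClosed_chartTorusGLoc L α w.1.1 S) (Measure.pi fun w : {w : {w : {w : InfinitePlace L // IsComplex w} // w ∉ S} // w.1 ≠ w₀} => ν'w w.1.1)) ha'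
  have hBΞ' : ∀ (c : ({w : InfinitePlace L // IsComplex w} → Fin 3 → ℝ)) (u : ↥(archLocal L 3 (Matrix.diagonal α) w₀)), INNER c u = Ξ (c, ((u : GL (Fin 3) ℂ) : Matrix (Fin 3) (Fin 3) ℂ)) := fun c u => by
    rw [hINNERdef]; exact hBΞ c u
  have hB0' : ∀ (c : ({w : InfinitePlace L // IsComplex w} → Fin 3 → ℝ)) (u : ↥(archLocal L 3 (Matrix.diagonal α) w₀)), u ∉ C₀ → INNER c u = 0 := fun c u hu => by
    rw [hINNERdef]; exact hB0 c u hu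
  /- (7) the smooth cut-off in the spectator coordinates -/
  obtain ⟨Box, hBoxdef⟩ : ∃ Box : Set ({w : InfinitePlace L // IsComplex w} → Fin 3 → ℝ), Box = {c : ({w : InfinitePlace L // IsComplex w} → Fin 3 → ℝ) | ∀ (i : {w : {w : {w : InfinitePlace L // IsComplex w} // w ∉ S} // w.1 ≠ w₀}) (a b : Fin 3), a ≠ b →
      slotSign L α i.1.1 a ≠ slotSign L α i.1.1 b → Circle.exp (c i.1.1 a) ≠ Circle.exp (c i.1.1 b)} := ⟨_, rfl⟩
  have hBoxo : IsOpen Box := by rw [hBoxdef]; exact isOpen_setOf_inRegAt L α (fun w : {w : {w : {w : InfinitePlace L // IsComplex w} // w ∉ S} // w.1 ≠ w₀} => w.1.1)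
  have hπ₀ : ContDiff ℝ ∞ fun c : ({w : InfinitePlace L // IsComplex w} → Fin 3 → ℝ) => Function.update c w₀ (0 : Fin 3 → ℝ) := by
    refine contDiff_pi.2 fun w => ?_
    rcases eq_or_ne w w₀ with rfl | hw
    · simp only [Function.update_self]
      exact contDiff_const
    · simp only [Function.update_of_ne hw]
      exact contDiff_apply ℝ (Fin 3 → ℝ) w
  have hx₀Box : Function.update x w₀ (0 : Fin 3 → ℝ) ∈ Box := by
    rw [hBoxdef]
    intro i a b hab hs
    rw [Function.update_of_ne i.2]
    exact hxin i.1.1 i.1.2 i.2 a b hab hs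
  obtain ⟨ε, hε, hball⟩ := Metric.isOpen_iff.1 hBoxo _ hx₀Box
  let χ : ContDiffBump (Function.update x w₀ (0 : Fin 3 → ℝ)) := ⟨ε / 4, ε / 2, by positivity, by linarith⟩
  have hχBox : tsupport (χ : ({w : InfinitePlace L // IsComplex w} → Fin 3 → ℝ) → ℝ) ⊆ Box := by
    rw [χ.tsupport_eq]
    exact (Metric.closedBall_subset_ball (by show ε / 2 < ε; linarith)).trans hball
  obtain ⟨Bt, hBtdef⟩ : ∃ Bt : ({w : InfinitePlace L // IsComplex w} → Fin 3 → ℝ) → ↥(archLocal L 3 (Matrix.diagonal α) w₀) → ℂ, Bt = fun y u => ((χ y : ℝ) : ℂ) * INNER y u := ⟨_, rfl⟩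
  obtain ⟨Ξt, hΞtdef⟩ : ∃ Ξt : ({w : InfinitePlace L // IsComplex w} → Fin 3 → ℝ) × Matrix (Fin 3) (Fin 3) ℂ → ℂ, Ξt = fun q : ({w : InfinitePlace L // IsComplex w} → Fin 3 → ℝ) × Matrix (Fin 3) (Fin 3) ℂ => ((χ q.1 : ℝ) : ℂ) * Ξ q := ⟨_, rfl⟩
  have hΞt : ContDiff ℝ ∞ Ξt := by
    rw [hΞtdef]
    refine contDiff_iff_contDiffAt.2 fun q => ?_
    by_cases hq : q.1 ∈ Box
    · have hnhds : Box ×ˢ (Set.univ : Set (Matrix (Fin 3) (Fin 3) ℂ)) ∈ 𝓝 q := (hBoxo.prod isOpen_univ).mem_nhds ⟨hq, Set.mem_univ _⟩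
      have h1 : ContDiffAt ℝ ∞ Ξ q := by
        have h := hΞs
        rw [hBoxdef] at hq
        exact (h q ⟨hq, Set.mem_univ _⟩).contDiffAt (by rw [hBoxdef] at hnhds; exact hnhds)
      exact ((Complex.ofRealCLM.contDiff.comp (χ.contDiff.comp contDiff_fst)).contDiffAt).mul h1
    · -- off `tsupport χ` the product vanishes near `q`
      have hq' : q.1 ∉ tsupport (χ : ({w : InfinitePlace L // IsComplex w} → Fin 3 → ℝ) → ℝ) := fun h => hq (hχBox h)
      have h0 : (fun q : ({w : InfinitePlace L // IsComplex w} → Fin 3 → ℝ) × Matrix (Fin 3) (Fin 3) ℂ => ((χ q.1 : ℝ) : ℂ) * Ξ q) =ᶠ[𝓝 q] fun _ => 0 := by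
        have hopen : IsOpen ((Prod.fst : ({w : InfinitePlace L // IsComplex w} → Fin 3 → ℝ) × Matrix (Fin 3) (Fin 3) ℂ → ({w : InfinitePlace L // IsComplex w} → Fin 3 → ℝ)) ⁻¹' (tsupport (χ : ({w : InfinitePlace L // IsComplex w} → Fin 3 → ℝ) → ℝ))ᶜ) :=
          (isClosed_tsupport _).isOpen_compl.preimage continuous_fst
        filter_upwards [hopen.mem_nhds hq'] with q' hq''
        rw [image_eq_zero_of_notMem_tsupport hq'', Complex.ofReal_zero, zero_mul]
      exact contDiffAt_const.congr_of_eventuallyEq h0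
  have hBtΞt : ∀ (y : ({w : InfinitePlace L // IsComplex w} → Fin 3 → ℝ)) (g : ↥(archLocal L 3 (Matrix.diagonal α) w₀)), Bt y g = Ξt (y, ((g : GL (Fin 3) ℂ) : Matrix (Fin 3) (Fin 3) ℂ)) := fun y g => by
    rw [hBtdef, hΞtdef]; dsimp only; rw [hBΞ']
  have hBtsupp : ∃ O ∈ 𝓝 (Function.update x w₀ (0 : Fin 3 → ℝ)), ∃ C : Set ↥(archLocal L 3 (Matrix.diagonal α) w₀), IsCompact C ∧ ∀ y ∈ O, ∀ g ∉ C, Bt y g = 0 :=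
    ⟨Set.univ, Filter.univ_mem, C₀, hC₀, fun y _ g hg => by rw [hBtdef]; dsimp only; rw [hB0' y g hg, mul_zero]⟩
  /- (8) L1: the ONE-PLACE PARAMETRIC BLOCK DESCENT at `w₀` (LH1-p03 (g6)) -/
  have hL1 : ∃ (K : ℂ) (O : Set ({w : InfinitePlace L // IsComplex w} → Fin 3 → ℝ)) (V₁ : Set (Fin 3 → ℝ)) (f : (({w : InfinitePlace L // IsComplex w} → Fin 3 → ℝ) × (Fin 3 → ℝ)) × Matrix (Fin 2) (Fin 2) ℂ → ℂ),
      K ≠ 0 ∧ IsOpen O ∧ Function.update x w₀ (0 : Fin 3 → ℝ) ∈ O ∧ IsOpen V₁ ∧ x w₀ ∈ V₁ ∧ ContDiff ℝ ∞ f ∧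
      (∃ C : Set (Matrix (Fin 2) (Fin 2) ℂ), IsCompact C ∧ ∀ y cw X, X ∉ C → f ((y, cw), X) = 0) ∧
      (∀ y cw X, f ((y, cw), X) = f ((y, ![0, cw 1, 0]), X)) ∧
      ∀ y ∈ O, ∀ cw ∈ V₁, Circle.exp (cw 0) ≠ Circle.exp (cw 2) →
        ∫ q, descConj (gprimeBlockAt L α w₀ S cw) (chartTorusGLoc L α w₀ S) (forall_mem_chartTorusGLoc_comm L α w₀ S cw) (Bt y) q
            ∂(quotientMeasure (chartTorusGLoc L α w₀ S) (chartHaarGLoc L α w₀ S) (isClosed_chartTorusGLoc L α w₀ S) (ν'w w₀)) =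
          K * ∫ h : ↥(unitaryGroupOfForm (starRingEnd ℂ) J),
            f ((y, cw), (((h * ⟨Matrix.GeneralLinearGroup.mkOfDetNeZero !![(1 : ℂ), 1; 1, -1] det_cayleyTwo_ne_zero *
                  circleDiagonal 2 ![Circle.exp (cw 0), Circle.exp (cw 2)] *
                  (Matrix.GeneralLinearGroup.mkOfDetNeZero !![(1 : ℂ), 1; 1, -1] det_cayleyTwo_ne_zero)⁻¹,
                cayley_conj_circleDiagonal_mem_of_eq_over hJ _⟩ * h⁻¹ : ↥(unitaryGroupOfForm (starRingEnd ℂ) J)) : GL (Fin 2) ℂ) : Matrix (Fin 2) (Fin 2) ℂ)) ∂μ₀ :=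
    exists_descent_box_local_param L α S w₀ (ν'w w₀) (chartHaarGLoc L α w₀ S) hα (hreal w₀) hJ μ₀ hw₀ hwsp hx02 hx1 (Function.update x w₀ (0 : Fin 3 → ℝ)) Bt Ξt hΞt hBtΞt hBtsupp
  obtain ⟨K₁, O, V₁, f, hK₁, hOo, hxO, hV₁o, hxV₁, hf, ⟨Cf, hCf, hfC⟩, hft, hid⟩ := hL1
  /- (9) assembling the package -/
  -- the box `U`
  obtain ⟨Wb, hWbdef⟩ : ∃ Wb : Set ({w : InfinitePlace L // IsComplex w} → Fin 3 → ℝ), Wb = {c : ({w : InfinitePlace L // IsComplex w} → Fin 3 → ℝ) |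
      (∀ j : Fin 3, j ≠ 1 → Circle.exp (c w₀ 1) ≠ Circle.exp (c w₀ j)) ∧
        (∀ w, w ∉ S → w ≠ w₀ → ∀ i j : Fin 3, i ≠ j → slotSign L α w i ≠ slotSign L α w j → Circle.exp (c w i) ≠ Circle.exp (c w j))} := ⟨_, rfl⟩
  have hWbo : IsOpen Wb := by rw [hWbdef]; exact isOpen_setOf_wallBox₂ L α S w₀
  have hxWb : x ∈ Wb := by
    rw [hWbdef]
    refine ⟨fun j hj => ?_, hxin⟩
    fin_cases j
    · exact hx1
    · exact absurd rfl hj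
    · exact fun h => hx1 (h.trans (congrArg Circle.exp hx02.symm))
  obtain ⟨U, hUdef⟩ : ∃ U : Set ({w : InfinitePlace L // IsComplex w} → Fin 3 → ℝ), U =
      ((fun c : ({w : InfinitePlace L // IsComplex w} → Fin 3 → ℝ) => Function.update c w₀ (0 : Fin 3 → ℝ)) ⁻¹' O ∩
        ((fun c : ({w : InfinitePlace L // IsComplex w} → Fin 3 → ℝ) => c w₀) ⁻¹' V₁ ∩
          (fun c : ({w : InfinitePlace L // IsComplex w} → Fin 3 → ℝ) => Function.update c w₀ (0 : Fin 3 → ℝ)) ⁻¹' Metric.ball (Function.update x w₀ (0 : Fin 3 → ℝ)) χ.rIn)) ∩ Wb := ⟨_, rfl⟩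
  have hUo : IsOpen U := by
    rw [hUdef]
    exact ((hOo.preimage hπ₀.continuous).inter ((hV₁o.preimage (continuous_apply w₀)).inter
      (Metric.isOpen_ball.preimage hπ₀.continuous))).inter hWbo
  have hxU : x ∈ U := by
    rw [hUdef]
    refine ⟨⟨?_, ?_, ?_⟩, hxWb⟩
    · show Function.update x w₀ (0 : Fin 3 → ℝ) ∈ O
      exact hxO
    · show x w₀ ∈ V₁
      exact hxV₁
    · show Function.update x w₀ (0 : Fin 3 → ℝ) ∈ Metric.ball (Function.update x w₀ (0 : Fin 3 → ℝ)) χ.rIn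
      exact Metric.mem_ball_self χ.rIn_pos
  -- the absorbed prefactor (no split `Δ_w`: the split places are unfolded)
  obtain ⟨R', hRdef⟩ : ∃ R' : ({w : InfinitePlace L // IsComplex w} → Fin 3 → ℝ) → ℂ, R' = fun c =>
      (∏ w ∈ (Finset.univ.filter (fun w => w ∉ S)).erase w₀,
          ((1 - (Circle.exp (c w 1 - c w 0) : ℂ)) * (1 - (Circle.exp (c w 2 - c w 0) : ℂ)) * (1 - (Circle.exp (c w 2 - c w 1) : ℂ)))) *
        (∏ w, ((chartHaarGLoc L α w S (chartBoxImgGLoc L α w S)).toReal : ℂ)) * ((∏ w : {w : {w : InfinitePlace L // IsComplex w} // w ∈ S}, (C w : ℝ) : ℝ) : ℂ) := ⟨_, rfl⟩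
  have hRs : ContDiff ℝ ∞ R' := by
    rw [hRdef]
    refine ((contDiff_prod fun w _ => ?_).mul contDiff_const).mul contDiff_const
    have he : ∀ i j : Fin 3, ContDiff ℝ ∞ fun c : ({w : InfinitePlace L // IsComplex w} → Fin 3 → ℝ) => (Circle.exp (c w j - c w i) : ℂ) := by
      intro i j
      have h : (fun c : ({w : InfinitePlace L // IsComplex w} → Fin 3 → ℝ) => (Circle.exp (c w j - c w i) : ℂ)) = fun c => Complex.exp (((c w j - c w i : ℝ) : ℂ) * I) :=
        funext fun c => Circle.coe_exp _
      rw [h]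
      exact Complex.contDiff_exp.comp ((Complex.ofRealCLM.contDiff.comp ((contDiff_apply_apply ℝ ℝ w j).sub (contDiff_apply_apply ℝ ℝ w i))).mul contDiff_const)
    exact ((contDiff_const.sub (he 0 1)).mul (contDiff_const.sub (he 0 2))).mul (contDiff_const.sub (he 1 2))
  have hRt : ∀ (c : ({w : InfinitePlace L // IsComplex w} → Fin 3 → ℝ)) (v : Fin 3 → ℝ), R' (Function.update c w₀ v) = R' c := fun c v => by
    rw [hRdef]
    dsimp only
    refine congrArg (fun z : ℂ => z * (∏ w, ((chartHaarGLoc L α w S (chartBoxImgGLoc L α w S)).toReal : ℂ)) *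
      ((∏ w : {w : {w : InfinitePlace L // IsComplex w} // w ∈ S}, (C w : ℝ) : ℝ) : ℂ)) ?_
    exact Finset.prod_congr rfl fun w hw => by rw [Function.update_of_ne (Finset.ne_of_mem_erase hw)]
  have hPREF : ∀ c : ({w : InfinitePlace L // IsComplex w} → Fin 3 → ℝ), (∏ w ∈ Finset.univ.filter (fun w => w ∉ S),
          ((1 - (Circle.exp (c w 1 - c w 0) : ℂ)) * (1 - (Circle.exp (c w 2 - c w 0) : ℂ)) * (1 - (Circle.exp (c w 2 - c w 1) : ℂ)))) *
        (∏ w, ((chartHaarGLoc L α w S (chartBoxImgGLoc L α w S)).toReal : ℂ)) * ((∏ w : {w : {w : InfinitePlace L // IsComplex w} // w ∈ S}, (C w : ℝ) : ℝ) : ℂ) =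
      (1 - (Circle.exp (c w₀ 1 - c w₀ 0) : ℂ)) * (1 - (Circle.exp (c w₀ 2 - c w₀ 0) : ℂ)) * (1 - (Circle.exp (c w₀ 2 - c w₀ 1) : ℂ)) * R' c := by
    intro c
    rw [hRdef]
    dsimp only
    have hw₀mem : w₀ ∈ Finset.univ.filter (fun w : {w : InfinitePlace L // IsComplex w} => w ∉ S) := Finset.mem_filter.2 ⟨Finset.mem_univ _, hw₀⟩
    rw [← Finset.mul_prod_erase _ _ hw₀mem]
    ring
  -- the package
  have hfs : ContDiff ℝ ∞ fun q : ({w : InfinitePlace L // IsComplex w} → Fin 3 → ℝ) × Matrix (Fin 2) (Fin 2) ℂ => R' q.1 * f ((Function.update q.1 w₀ (0 : Fin 3 → ℝ), q.1 w₀), q.2) := by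
    have h1 : ContDiff ℝ ∞ fun q : ({w : InfinitePlace L // IsComplex w} → Fin 3 → ℝ) × Matrix (Fin 2) (Fin 2) ℂ => ((Function.update q.1 w₀ (0 : Fin 3 → ℝ), q.1 w₀), q.2) :=
      ((hπ₀.comp contDiff_fst).prodMk ((contDiff_apply ℝ (Fin 3 → ℝ) w₀).comp contDiff_fst)).prodMk contDiff_snd
    exact (hRs.comp contDiff_fst).mul (hf.comp h1)
  refine ⟨K₁, U, fun q => R' q.1 * f ((Function.update q.1 w₀ (0 : Fin 3 → ℝ), q.1 w₀), q.2), hK₁, hUo, hxU, hfs,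
    ⟨Cf, hCf, fun c X hX => by dsimp only; rw [hfC _ _ X hX, mul_zero]⟩, fun c X => ?_, ?_, ?_⟩
  · -- tangential clause
    dsimp only
    rw [hRt, Function.update_idem, Function.update_self, hft (Function.update c w₀ 0) (c w₀) X]
  · -- the box meets `InRegG` off the `w₀`-wall
    rintro c hcU hc02
    rw [hUdef] at hcU
    obtain ⟨-, hcW⟩ := hcU
    rw [hWbdef] at hcW
    intro w hw i j hij hs
    by_cases hww : w = w₀
    · subst hww
      have h1 := hcW.1
      fin_cases i <;> fin_cases j
      · exact absurd rfl hij
      · exact fun h => h1 0 (by decide) h.symm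
      · exact hc02
      · exact h1 0 (by decide)
      · exact absurd rfl hij
      · exact h1 2 (by decide)
      · exact fun h => hc02 h.symm
      · exact fun h => h1 2 (by decide) h.symm
      · exact absurd rfl hij
    · exact hcW.2 w hw hww i j hij hs
  · -- the identity at `G`-regular points of the box
    rintro c hcU hcreg
    rw [hUdef] at hcU
    obtain ⟨⟨hcO, hcV, hcball⟩, -⟩ := hcU
    have hoff : Circle.exp (c w₀ 0) ≠ Circle.exp (c w₀ 2) := fun h =>
      absurd (((mem_regG_iff S c).1 hcreg).1 w₀ hw₀ h) (by decide)
    have hχ1 : χ (Function.update c w₀ (0 : Fin 3 → ℝ)) = 1 := χ.one_of_mem_closedBall (Metric.ball_subset_closedBall hcball)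
    -- the inner family at `c` IS the cut-off family at the spectator point `update c w₀ 0`
    have hfun : INNER c = Bt (Function.update c w₀ (0 : Fin 3 → ℝ)) := by
      funext u
      rw [hBtdef]
      dsimp only
      rw [hχ1, Complex.ofReal_one, one_mul, hBΞ', hBΞ', hΞw₀]
    rw [hA c hcreg, hfun, hid _ hcO _ hcV hoff, hPREF]
    dsimp only
    rw [integral_const_mul]
    ring


/-- **THE (B-desc′) HEAD AT EVERY ONE-WALL POINT — box descent of the EXTENDED genuine family `orbFamGExt`** (LH7-p04 (g4)'s signature, ★ p851168's 8 clauses VERBATIM; no real-wall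
hypothesis): the core package of `exists_descent_box_orbFamG_corePackage` through ★ p851168 `exists_descent_box_orbFamGExt_inRegG_of_corePackage` ((H-cont) + the dock `RegG → InRegG`).
[cite: Varadarajan1977, I §1.12] [cite: Rogawski1990, §4.12 Lemma 4.12.1 p. 61; §8.2 pp. 119–124] [cite: Bouaziz1994IntegralesOrbitales, §6.2 p. 591] [cite: Shelstad1979, §4 pp. 22–25] -/
theorem exists_descent_box_orbFamGExt_inRegG (hα : ∀ i, α i ≠ 0)
    (hreal : ∀ (w : {w : InfinitePlace L // IsComplex w}) (i : Fin 3), (w.1.embedding (α i)).im = 0)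
    {J : Matrix (Fin 2) (Fin 2) ℂ} (hJ : J = (StdForm.antidiagonal 2).over ℂ)
    [MeasurableSpace ↥(unitaryGroupOfForm (starRingEnd ℂ) J)] [BorelSpace ↥(unitaryGroupOfForm (starRingEnd ℂ) J)]
    [LocallyCompactSpace ↥(unitaryGroupOfForm (starRingEnd ℂ) J)] [SecondCountableTopology ↥(unitaryGroupOfForm (starRingEnd ℂ) J)]
    (μ₀ : Measure ↥(unitaryGroupOfForm (starRingEnd ℂ) J)) [μ₀.IsHaarMeasure] [μ₀.IsMulRightInvariant]
    {S : Finset {w : InfinitePlace L // IsComplex w}} {w₀ : {w : InfinitePlace L // IsComplex w}} {x : ({w : InfinitePlace L // IsComplex w} → Fin 3 → ℝ)}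
    (hS : ∀ w, w ∈ S → w ∈ splitChartPlaces L α) (hw₀ : w₀ ∉ S) (hwsp : w₀ ∈ splitChartPlaces L α)
    (hx02 : x w₀ 0 = x w₀ 2) (hx1 : Circle.exp (x w₀ 1) ≠ Circle.exp (x w₀ 0))
    (hxin : ∀ w, w ∉ S → w ≠ w₀ → ∀ i j : Fin 3, i ≠ j → slotSign L α w i ≠ slotSign L α w j → Circle.exp (x w i) ≠ Circle.exp (x w j))
    {a' : ↥(arch (↥(maximalRealSubfield L)) L (IsCMField.complexConj L) 3 (Matrix.diagonal α)) → ℂ} (ha' : ArchSmooth L 3 (Matrix.diagonal α) a') :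
    ∃ (K : ℂ) (U : Set ({w : InfinitePlace L // IsComplex w} → Fin 3 → ℝ)) (f : ({w : InfinitePlace L // IsComplex w} → Fin 3 → ℝ) × Matrix (Fin 2) (Fin 2) ℂ → ℂ),
      K ≠ 0 ∧ IsOpen U ∧ x ∈ U ∧ ContDiff ℝ ∞ f ∧
      (∃ C : Set (Matrix (Fin 2) (Fin 2) ℂ), IsCompact C ∧ ∀ c X, X ∉ C → f (c, X) = 0) ∧
      (∀ c X, f (c, X) = f (Function.update c w₀ ![0, c w₀ 1, 0], X)) ∧
      (∀ c ∈ U, Circle.exp (c w₀ 0) ≠ Circle.exp (c w₀ 2) → c ∈ InRegG (slotSign L α) S) ∧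
      ∀ c ∈ U, Circle.exp (c w₀ 0) ≠ Circle.exp (c w₀ 2) →
        orbFamGExt L α ν' a' S c =
          (1 - (Circle.exp (c w₀ 1 - c w₀ 0) : ℂ)) * (1 - (Circle.exp (c w₀ 2 - c w₀ 0) : ℂ)) * (1 - (Circle.exp (c w₀ 2 - c w₀ 1) : ℂ)) *
          (K * ∫ h : ↥(unitaryGroupOfForm (starRingEnd ℂ) J),
            f (c, (((h * ⟨Matrix.GeneralLinearGroup.mkOfDetNeZero !![(1 : ℂ), 1; 1, -1] det_cayleyTwo_ne_zero *
                  circleDiagonal 2 ![Circle.exp (c w₀ 0), Circle.exp (c w₀ 2)] *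
                  (Matrix.GeneralLinearGroup.mkOfDetNeZero !![(1 : ℂ), 1; 1, -1] det_cayleyTwo_ne_zero)⁻¹,
                cayley_conj_circleDiagonal_mem_of_eq_over hJ _⟩ * h⁻¹ : ↥(unitaryGroupOfForm (starRingEnd ℂ) J)) : GL (Fin 2) ℂ) : Matrix (Fin 2) (Fin 2) ℂ)) ∂μ₀) :=
  exists_descent_box_orbFamGExt_inRegG_of_corePackage L α ν' hJ μ₀
    (exists_descent_box_orbFamG_corePackage L α ν' hα hreal hJ μ₀ hS hw₀ hwsp hx02 hx1 hxin ha')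

end Core


end Literature.NumberTheory.Rogawski1990

end
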